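import Summits.NavierStokesRegularity.FluidComputer.LerayClock
import HarnessLib

/-!
# Fluid computer — the TIME FACE of the level dictionary, II: THE CLOCK IN LEVEL CURRENCY (L20)

HONEST FRAMING (cell `pub-fluidc`, verbatim): *low prior, high value-of-information experiment on Tao's
machine paradigm; NOT a claim that NS blows up.* Theorem side of the cell; nothing here is evidence of blow-up.
Companion of `LerayClock` (L19, `enstrophy_clock`: `c ν³ ≤ (∫|∇u(t)|²)² (T − t)` at every instant of every
maximal smooth Leray–Hopf solution): the same countdown in the currency of the Littlewood–Paley levels
`a_l(t) = ‖Δ̇_l u(t)‖₂`, with the dyadic enstrophy `F(v) = ∑_{l∈ℤ} 4^l ‖Δ̇_l v‖₂²` (`dyadicF`), the tails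
`Tail_q(t) = ∑_{n≥0} 4^{q+n} ‖Δ̇_{q+n} u(t)‖₂²` and the toolbox Bernstein constant `C_b` (`lpBounds (Fin 3)`):

* `dyadicF_clock` (**L20, THE DYADIC ENSTROPHY CLOCK**) — `c ν³ ≤ (6 C_b² F(u(t)))² (T − t)` for every
  `t ∈ (0, T)` (forward Bernstein on each block and the lower square-function bound, `LPBounds.gradSq_le_dyadicF`).
* `dyadicF_eq_low_add_tail`, `dyadicF_le_head_add_tail` (FIXED-LEVEL bookkeeping) — `F = (∑_{l<q} + Tail_q)` and
  `F(u(t)) ≤ 8·4^q ‖u(0)‖₂² + Tail_q(t)` for every `t ∈ [0, T)` and every `q`: the levels below `q` hold at most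
  `8·4^q ×` the energy, which does not increase (square function + Leray's energy inequality).
* `front_clock` (**L20′, THE ENSTROPHY-FRONT CLOCK**) — `c ν³ ≤ (6 C_b² (8·4^q‖u(0)‖₂² + Tail_q(t)))² (T − t)`
  for every `q` and every `t ∈ (0, T)`: at each instant either the levels at and above `q` already carry dyadic
  enstrophy of size `√(ν³/(T − t))`, or the blow-up is still far.
* `countdown` (**L20″, THE PER-LEVEL COUNTDOWN**, real numbers) — if at time `t` the front has not passed level
  `q` (`Tail_q(t) ≤ 8·4^q‖u(0)‖₂²`), then `c ν³ ≤ 9216 C_b⁴ 16^q ‖u(0)‖₂⁴ (T − t)`: EACH LEVEL THE ENSTROPHY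
  FRONT HAS NOT YET PASSED CERTIFIES TIME `∝ 16^{−q}`; equivalently the front `q(t)` must climb at least like
  `2^{q(t)} ≳ ν^{3/4} ‖u(0)‖₂^{−1} (T − t)^{−1/4}` — in the machine's words, the hand-off clock must ACCELERATE
  geometrically, and the time-to-blow-up is paid for level by level.

HONEST SIZE NOTE: `c` is inexplicit and the clocks carry `ν³` (`≈ 3.7·10⁻⁸` at the cell's `ρ = 3`) against
`‖u(0)‖₂⁴ 16^q`: read against WORDS, never against a certified number of the atlas; the exponent `1/4` is the
energy-class (Leray `H¹`) exponent, not the self-similar `1/2`. Necessity only. 0 sorry; no new definitions, no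
named facts.

## References

* J. Leray, Acta Math. 63 (1934) 193–248, §20. [Leray1934]
* J. C. Robinson, J. L. Rodrigo, W. Sadowski, *The Three-Dimensional Navier–Stokes Equations*, CUP 2016,
  Lemma 6.11. [RobinsonRodrigoSadowski2016]
* H. Bahouri, J.-Y. Chemin, R. Danchin, *Fourier Analysis and Nonlinear PDE*, Springer 2011, Lemma 2.1,
  Prop. 2.12 (Bernstein, square function). [BahouriCheminDanchin2011]
-/

noncomputable section

open MeasureTheory Set Function Filter Topology Metric
open scoped ENNReal NNReal RealInnerProductSpace
open Literature.Analysis.FluidPDE Literature.Analysis.FunctionSpaces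
open Literature.Analysis.FluidPDE.LPBounds (gradSq)
open Summit.NavierStokesRegularity.FluidComputer.BlockEnergyTransport
open Summit.NavierStokesRegularity.FluidComputer.LerayClock

namespace Summit.NavierStokesRegularity.FluidComputer.LerayFrontClock

/-! ## L20: the clock in level currency -/

/-- **L20 — THE DYADIC ENSTROPHY CLOCK.** With the constant `c` of `enstrophy_clock`, the Littlewood–Paley
toolbox `K = lpBounds (Fin 3)` and the dyadic enstrophy `F(v) = ∑_{l∈ℤ} 4^l ‖Δ̇_l v‖₂²` (`dyadicF`): for every
maximal smooth Leray–Hopf solution and EVERY `t ∈ (0, T)`,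
`c ν³ ≤ (6 C_b² F(u(t)))² · (T − t)` — the enstrophy is at most `6 C_b²` times its dyadic form (forward Bernstein
on each block and the lower square-function bound, `LPBounds.gradSq_le_dyadicF`), so the levels' weighted
energies `4^l a_l(t)²` must sum to at least `√(c ν³/(T − t))/(6 C_b²)` at every instant.
[cite: RobinsonRodrigoSadowski2016, Lemma 6.11] [cite: BahouriCheminDanchin2011, Lemma 2.1 and Prop. 2.12] -/
theorem dyadicF_clock :
    ∃ c : ℝ, 0 < c ∧ ∀ (ν T : ℝ), 0 < ν → 0 < T →
      ∀ (u : ℝ → EuclideanSpace ℝ (Fin 3) → EuclideanSpace ℝ (Fin 3)) (p : ℝ → EuclideanSpace ℝ (Fin 3) → ℝ),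
      IsMaximalSmoothSolution ν 0 u p T → IsLerayHopfOn T ν 0 (u 0) u →
      ∀ t ∈ Ioo 0 T, ENNReal.ofReal (c * ν ^ 3) ≤
        (6 * ((lpBounds (Fin 3)).Cb : ℝ≥0∞) ^ 2 * dyadicF (u t)) ^ 2 * ENNReal.ofReal (T - t) := by
  obtain ⟨c, hc, H⟩ := enstrophy_clock
  refine ⟨c, hc, fun ν T hν hT u p hmax hLH t ht => ?_⟩
  set K := lpBounds (Fin 3) with hK
  have hw : IsSmoothL2Field (u t) := isSmoothL2Field_slice_of_maximal hν hT hmax hLH ht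
  have h := H ν T hν hT u p hmax hLH t ⟨ht.1.le, ht.2⟩
  obtain ⟨hZ, -⟩ := lintegral_frobeniusNormSq_eq_gradSq hν hT hmax hLH ht
  rw [hZ] at h
  have hg : gradSq (u t) ≤ 6 * (K.Cb : ℝ≥0∞) ^ 2 * dyadicF (u t) := by
    refine (K.gradSq_le_dyadicF hw).trans_eq ?_
    rw [Fintype.card_fin]
    push_cast
    ring
  exact h.trans (by gcongr)

/-- **The tail of the dyadic enstrophy above level `q` is part of it**: for every field `v` and level `q`,
`∑_{n ≥ 0} 4^{q+n} ‖Δ̇_{q+n} v‖₂² ≤ F(v)` — in fact `F(v) = (∑_{l<q} + ∑_{l≥q}) 4^l ‖Δ̇_l v‖₂²`, reindexing the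
second sum by `l = q + n`. [folklore] -/
theorem dyadicF_eq_low_add_tail (v : EuclideanSpace ℝ (Fin 3) → EuclideanSpace ℝ (Fin 3)) (q : ℕ) :
    dyadicF v = (∑' l : {l : ℤ // l < (q : ℤ)}, ((2 : ℝ≥0∞) ^ (l : ℤ) * blockL2 v l) ^ 2) +
      ∑' n : ℕ, (2 : ℝ≥0∞) ^ (2 * (q + n)) * blockL2 v ((q + n : ℕ) : ℤ) ^ 2 := by
  unfold dyadicF dyadicSqSum
  have hsplit := (ENNReal.summable.tsum_add_tsum_compl (s := {l : ℤ | l < (q : ℤ)})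
    (f := fun l : ℤ => ((2 : ℝ≥0∞) ^ l * blockL2 v l) ^ 2) ENNReal.summable)
  rw [← hsplit]
  congr 1
  -- reindex the sum over `{l | ¬ l < q} = {l | q ≤ l}` by `l = q + n`
  let e : ℕ ≃ {l : ℤ // l ∈ ({l : ℤ | l < (q : ℤ)} : Set ℤ)ᶜ} :=
    { toFun := fun n => ⟨(q : ℤ) + n, by simp⟩
      invFun := fun l => (l.1 - q).toNat
      left_inv := fun n => by simp
      right_inv := fun l => by
        obtain ⟨l, hl⟩ := l
        have hl' : (q : ℤ) ≤ l := by
          simp only [mem_compl_iff, mem_setOf_eq, not_lt] at hl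
          exact hl
        refine Subtype.ext ?_
        show (q : ℤ) + (((l - q).toNat : ℕ) : ℤ) = l
        rw [Int.toNat_of_nonneg (sub_nonneg.2 hl')]
        ring }
  have he : ∀ n : ℕ, ((e n : {l : ℤ // l ∈ ({l : ℤ | l < (q : ℤ)} : Set ℤ)ᶜ}) : ℤ) = (q : ℤ) + n :=
    fun n => rfl
  rw [← e.tsum_eq]
  refine tsum_congr fun n => ?_
  rw [he n, show ((q : ℤ) + (n : ℤ)) = ((q + n : ℕ) : ℤ) by push_cast; ring, zpow_natCast,
    mul_pow, ← pow_mul, mul_comm (q + n) 2]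

/-- **FIXED-LEVEL BOOKKEEPING — the levels below `q` hold at most `8 · 4^q ×` the energy.** Along every maximal
smooth Leray–Hopf solution, for every `t ∈ [0, T)` and every level `q`:
`F(u(t)) ≤ 8 · 4^q ‖u(0)‖₂² + ∑_{n ≥ 0} 4^{q+n} ‖Δ̇_{q+n} u(t)‖₂²` (weights `4^l ≤ 4^q` below `q`, the square-function
bound `∑_l ‖Δ̇_l v‖₂² ≤ 8‖v‖₂²`, and Leray's energy inequality `‖u(t)‖₂ ≤ ‖u(0)‖₂`).
[cite: BahouriCheminDanchin2011, Prop. 2.12] -/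
theorem dyadicF_le_head_add_tail {ν T : ℝ} (hν : 0 < ν) (hT : 0 < T)
    {u : ℝ → EuclideanSpace ℝ (Fin 3) → EuclideanSpace ℝ (Fin 3)}
    (hLH : IsLerayHopfOn T ν 0 (u 0) u) {t : ℝ} (ht : t ∈ Ico 0 T) (q : ℕ) :
    dyadicF (u t) ≤ 8 * (2 : ℝ≥0∞) ^ (2 * q) * eLpNorm (u 0) 2 volume ^ 2 +
      ∑' n : ℕ, (2 : ℝ≥0∞) ^ (2 * (q + n)) * blockL2 (u t) ((q + n : ℕ) : ℤ) ^ 2 := by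
  set K := lpBounds (Fin 3) with hK
  have hut : MemLp (u t) 2 volume := hLH.memLp t ⟨ht.1, ht.2.le⟩
  -- the low levels: `∑_{l<q} (2^l a_l)² ≤ 4^q ∑_l a_l² ≤ 8 · 4^q ‖u(t)‖₂² ≤ 8 · 4^q ‖u(0)‖₂²`
  have h2q : ∀ l : {l : ℤ // l < (q : ℤ)}, ((2 : ℝ≥0∞) ^ (l : ℤ)) ^ 2 ≤ (2 : ℝ≥0∞) ^ (2 * q) := by
    intro l
    have h2l : (2 : ℝ≥0∞) ^ (l : ℤ) ≤ (2 : ℝ≥0∞) ^ (q : ℤ) := ENNReal.zpow_le_of_le (by norm_num) l.2.le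
    calc ((2 : ℝ≥0∞) ^ (l : ℤ)) ^ 2 ≤ ((2 : ℝ≥0∞) ^ (q : ℤ)) ^ 2 := pow_le_pow_left' h2l 2
      _ = (2 : ℝ≥0∞) ^ (2 * q) := by rw [zpow_natCast, ← pow_mul, mul_comm]
  have hlow : ∀ l : {l : ℤ // l < (q : ℤ)}, ((2 : ℝ≥0∞) ^ (l : ℤ) * blockL2 (u t) l) ^ 2 ≤
      (2 : ℝ≥0∞) ^ (2 * q) * blockL2 (u t) l ^ 2 := by
    intro l
    rw [mul_pow]
    exact mul_le_mul' (h2q l) le_rfl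
  have hhead : ∑' l : {l : ℤ // l < (q : ℤ)}, ((2 : ℝ≥0∞) ^ (l : ℤ) * blockL2 (u t) l) ^ 2 ≤
      8 * (2 : ℝ≥0∞) ^ (2 * q) * eLpNorm (u 0) 2 volume ^ 2 :=
    calc ∑' l : {l : ℤ // l < (q : ℤ)}, ((2 : ℝ≥0∞) ^ (l : ℤ) * blockL2 (u t) l) ^ 2
        ≤ ∑' l : {l : ℤ // l < (q : ℤ)}, (2 : ℝ≥0∞) ^ (2 * q) * blockL2 (u t) l ^ 2 :=
          ENNReal.tsum_le_tsum hlow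
      _ = (2 : ℝ≥0∞) ^ (2 * q) * ∑' l : {l : ℤ // l < (q : ℤ)}, blockL2 (u t) l ^ 2 := ENNReal.tsum_mul_left
      _ ≤ (2 : ℝ≥0∞) ^ (2 * q) * ∑' l : ℤ, blockL2 (u t) l ^ 2 :=
          mul_le_mul' le_rfl (ENNReal.tsum_comp_le_tsum_of_injective Subtype.val_injective
            (fun l : ℤ => blockL2 (u t) l ^ 2))
      _ ≤ (2 : ℝ≥0∞) ^ (2 * q) * (8 * eLpNorm (u t) 2 volume ^ 2) := mul_le_mul' le_rfl (K.sq_le _ hut)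
      _ ≤ (2 : ℝ≥0∞) ^ (2 * q) * (8 * eLpNorm (u 0) 2 volume ^ 2) := by
          gcongr
          exact hLH.eLpNorm_le_eLpNorm_datum hν.le (hLH.memLp 0 ⟨le_rfl, hT.le⟩) ⟨ht.1, ht.2.le⟩
      _ = 8 * (2 : ℝ≥0∞) ^ (2 * q) * eLpNorm (u 0) 2 volume ^ 2 := by ring
  rw [dyadicF_eq_low_add_tail (u t) q]
  exact add_le_add hhead le_rfl

/-- **L20′ — THE ENSTROPHY-FRONT CLOCK.** With the constant `c` of `enstrophy_clock`: along every maximal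
smooth Leray–Hopf solution, for EVERY `t ∈ (0, T)` and EVERY level `q`,
`c ν³ ≤ (6 C_b² (8·4^q ‖u(0)‖₂² + Tail_q(t)))² · (T − t)`, `Tail_q(t) = ∑_{n≥0} 4^{q+n}‖Δ̇_{q+n} u(t)‖₂²`:
at each instant EITHER the levels at and above `q` already carry dyadic enstrophy comparable to
`√(ν³/(T − t))`, OR the blow-up is still far — the enstrophy front must climb, level after level, at least like
`2^{q(t)} ≳ ν^{3/4}‖u(0)‖₂^{-1}(T − t)^{-1/4}`. (`dyadicF_clock` with `dyadicF_le_head_add_tail`.)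
[cite: RobinsonRodrigoSadowski2016, Lemma 6.11] [cite: BahouriCheminDanchin2011, Lemma 2.1 and Prop. 2.12] -/
theorem front_clock :
    ∃ c : ℝ, 0 < c ∧ ∀ (ν T : ℝ), 0 < ν → 0 < T →
      ∀ (u : ℝ → EuclideanSpace ℝ (Fin 3) → EuclideanSpace ℝ (Fin 3)) (p : ℝ → EuclideanSpace ℝ (Fin 3) → ℝ),
      IsMaximalSmoothSolution ν 0 u p T → IsLerayHopfOn T ν 0 (u 0) u →
      ∀ t ∈ Ioo 0 T, ∀ q : ℕ, ENNReal.ofReal (c * ν ^ 3) ≤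
        (6 * ((lpBounds (Fin 3)).Cb : ℝ≥0∞) ^ 2 * (8 * (2 : ℝ≥0∞) ^ (2 * q) * eLpNorm (u 0) 2 volume ^ 2 +
          ∑' n : ℕ, (2 : ℝ≥0∞) ^ (2 * (q + n)) * blockL2 (u t) ((q + n : ℕ) : ℤ) ^ 2)) ^ 2 *
          ENNReal.ofReal (T - t) := by
  obtain ⟨c, hc, H⟩ := dyadicF_clock
  refine ⟨c, hc, fun ν T hν hT u p hmax hLH t ht q => ?_⟩
  have h := H ν T hν hT u p hmax hLH t ht
  have htail := dyadicF_le_head_add_tail hν hT hLH ⟨ht.1.le, ht.2⟩ q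
  exact h.trans (by gcongr)

/-- **L20″ — THE COUNTDOWN: each level the enstrophy front has not passed certifies time.** With the constant
`c` of `enstrophy_clock`: along every maximal smooth Leray–Hopf solution, at every `t ∈ (0, T)` and for every
level `q`, IF the levels at and above `q` hold no more dyadic enstrophy than the energy class lets the levels
below `q` hold — `Tail_q(t) = ∑_{n≥0} 4^{q+n}‖Δ̇_{q+n} u(t)‖₂² ≤ 8·4^q‖u(0)‖₂²` ('the front has not passed `q`') —
THEN `c ν³ ≤ 9216 · C_b⁴ · 16^q · ‖u(0)‖₂⁴ · (T − t)`, i.e. the blow-up is at least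
`c ν³ ‖u(0)‖₂⁻⁴ / (9216 C_b⁴ 16^q)` away (real numbers; `‖u(0)‖₂ = (eLpNorm (u 0) 2).toReal`).
[cite: RobinsonRodrigoSadowski2016, Lemma 6.11] [cite: BahouriCheminDanchin2011, Lemma 2.1 and Prop. 2.12] -/
theorem countdown :
    ∃ c : ℝ, 0 < c ∧ ∀ (ν T : ℝ), 0 < ν → 0 < T →
      ∀ (u : ℝ → EuclideanSpace ℝ (Fin 3) → EuclideanSpace ℝ (Fin 3)) (p : ℝ → EuclideanSpace ℝ (Fin 3) → ℝ),
      IsMaximalSmoothSolution ν 0 u p T → IsLerayHopfOn T ν 0 (u 0) u →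
      ∀ t ∈ Ioo 0 T, ∀ q : ℕ,
        (∑' n : ℕ, (2 : ℝ≥0∞) ^ (2 * (q + n)) * blockL2 (u t) ((q + n : ℕ) : ℤ) ^ 2) ≤
          8 * (2 : ℝ≥0∞) ^ (2 * q) * eLpNorm (u 0) 2 volume ^ 2 →
        c * ν ^ 3 ≤ 9216 * ((lpBounds (Fin 3)).Cb : ℝ) ^ 4 * (16 : ℝ) ^ q *
          (eLpNorm (u 0) 2 volume).toReal ^ 4 * (T - t) := by
  obtain ⟨c, hc, H⟩ := front_clock
  refine ⟨c, hc, fun ν T hν hT u p hmax hLH t ht q hfront => ?_⟩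
  set K := lpBounds (Fin 3) with hK
  set E : ℝ≥0∞ := eLpNorm (u 0) 2 volume with hE
  have hEtop : E ≠ ⊤ := (hLH.memLp 0 ⟨le_rfl, hT.le⟩).eLpNorm_ne_top
  have hTt : 0 ≤ T - t := (sub_pos.2 ht.2).le
  have h := H ν T hν hT u p hmax hLH t ht q
  -- under the front hypothesis the bracket is at most `16 · 4^q ‖u(0)‖₂²`
  have h2 : (6 * (K.Cb : ℝ≥0∞) ^ 2 * (8 * (2 : ℝ≥0∞) ^ (2 * q) * E ^ 2 +
      ∑' n : ℕ, (2 : ℝ≥0∞) ^ (2 * (q + n)) * blockL2 (u t) ((q + n : ℕ) : ℤ) ^ 2)) ^ 2 * ENNReal.ofReal (T - t) ≤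
      (6 * (K.Cb : ℝ≥0∞) ^ 2 * (8 * (2 : ℝ≥0∞) ^ (2 * q) * E ^ 2 + 8 * (2 : ℝ≥0∞) ^ (2 * q) * E ^ 2)) ^ 2 *
        ENNReal.ofReal (T - t) := by
    gcongr
  -- the bracket as a product: `X = 96 C_b² 4^q ‖u(0)‖₂²`, finite
  set X : ℝ≥0∞ := 6 * (K.Cb : ℝ≥0∞) ^ 2 * (8 * (2 : ℝ≥0∞) ^ (2 * q) * E ^ 2 + 8 * (2 : ℝ≥0∞) ^ (2 * q) * E ^ 2)
    with hX
  have hX' : X = 96 * (K.Cb : ℝ≥0∞) ^ 2 * (2 : ℝ≥0∞) ^ (2 * q) * E ^ 2 := by rw [hX]; ring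
  have hXtop : X ≠ ⊤ := by
    rw [hX']
    exact ENNReal.mul_ne_top (ENNReal.mul_ne_top (ENNReal.mul_ne_top (by norm_num)
      (ENNReal.pow_ne_top ENNReal.coe_ne_top)) (ENNReal.pow_ne_top (by norm_num))) (ENNReal.pow_ne_top hEtop)
  have hYtop : X ^ 2 * ENNReal.ofReal (T - t) ≠ ⊤ := ENNReal.mul_ne_top (ENNReal.pow_ne_top hXtop) ENNReal.ofReal_ne_top
  have h3 : ENNReal.ofReal (c * ν ^ 3) ≤ X ^ 2 * ENNReal.ofReal (T - t) := h.trans h2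
  -- convert to real numbers
  have h4 := ENNReal.toReal_mono hYtop h3
  rw [ENNReal.toReal_ofReal (by positivity), ENNReal.toReal_mul, ENNReal.toReal_pow,
    ENNReal.toReal_ofReal hTt, hX'] at h4
  simp only [ENNReal.toReal_mul, ENNReal.toReal_pow, ENNReal.toReal_ofNat, ENNReal.coe_toReal] at h4
  refine h4.trans_eq ?_
  have h16 : (16 : ℝ) ^ q = ((2 : ℝ) ^ (2 * q)) ^ 2 := by
    rw [← pow_mul, show (16 : ℝ) = 2 ^ 4 by norm_num, ← pow_mul]; ring_nf
  rw [h16]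
  ring

end Summit.NavierStokesRegularity.FluidComputer.LerayFrontClock

end
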